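import Literature.Computability.Complexity.RandomizedModularZeroTestHeight
import Literature.Computability.AlgebraicComplexity.CircuitCodeModularEvaluator
import Literature.Barriers.ValiantsHypothesis.BIJL18Thm5OfRandomizedPIT
import HarnessLib

/-!
# Bläser–Ikenmeyer–Jindal–Lysikov 2018, Thm. 5 — DISCHARGED: `BIJL2018_thm5_holds`
# (`VP⁰ = VNP⁰ ⇒ P^{#P} ⊆ ∃·BPP`)

Discharge file of the typed fact `Literature.Barriers.ValiantsHypothesis.BIJL2018_thm5`
(`BIJL18PermanentZero.lean`; M. Bläser, C. Ikenmeyer, G. Jindal, V. Lysikov, *Generalized matrix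
completion and algebraic natural proofs*, STOC 2018 = ECCC TR18-064, Thm. 5). The reduction
`BIJL2018_thm5_of_randomizedPIT` (`BIJL18Thm5OfRandomizedPIT.lean`) left exactly one hypothesis: a
`BPP` language agreeing with `PITLanguage` on the values of the Kabanets–Impagliazzo reduction
`kiRed` (codes of division-free integer circuits). Here it is supplied:

* `semPolyZero_mem_BPP` — `{w | CircuitCode.semPoly w = 0} ∈ BPP`: the randomised modular zero test
  (random point of `[0, 2^k)^n`, random `K`-bit modulus; Schwartz 1980 / Ibarra–Moran 1983 — in the
  tree `ModularZeroTest.mem_BPP_of_modularZeroTest_height`) applied to the junk-tolerant semantics of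
  circuit codes (`CircuitCodeReading.lean`: `semPoly`, degree `≤ 2^{n²}`, height
  `≤ 2^{2^{n²+3n}(B+1)}`) with the `FP` evaluator `CircuitCode.evalF`
  (`CircuitCodeModularEvaluator.lean`) and the parameter polynomials `KPoly`, `kPoly`;
* `kiRed_mem_semPolyZero_iff` — on every `kiRed w` (a circuit word over `n²` variables with `≥ n²`
  gates, or the rejected word) the test agrees with `PITLanguage`
  (`CircuitCode.semPoly_circuitWord_eq_zero_iff`);
* **`BIJL2018_thm5_holds : BIJL2018_thm5`**.

DEVIATION from the printed proof, disclosed in the docstring of `BIJL2018_thm5_holds`: the guessed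
circuits are certified through Kabanets–Impagliazzo's single identity-test instance, tested modulo a
random number, rather than by direct evaluation with the coefficient bound of BIJL's Lemma 25.
HONEST FRAMING: a published conditional theorem with a Boolean conclusion formalised; `VP ≠ VNP` is
NOT proved and nothing here bears on it.

## References

* M. Bläser, C. Ikenmeyer, G. Jindal, V. Lysikov, STOC 2018 = ECCC TR18-064, Thm. 5, §6
  [BlaserIkenmeyerJindalLysikov2018].
* V. Kabanets, R. Impagliazzo, STOC 2003, Lemma 3, Lemma 11, Cor. 12 [KabanetsImpagliazzo2003];
  Comput. Complexity 13 (2004), §2 [KabanetsImpagliazzo2004].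
* J. T. Schwartz, J. ACM 27 (1980) [Schwartz1980]; O. H. Ibarra, S. Moran, J. ACM 30 (1983)
  [IbarraMoran1983]; S. Arora, B. Barak, CUP 2009, Lemma 7.5, §7.2.3 [AroraBarakCC2009].
* L. G. Valiant, TCS 8 (1979), Thm. 1 [Valiant1979].
-/

noncomputable section

namespace Literature.Barriers.ValiantsHypothesis

open Literature.Computability.Complexity Literature.Computability.AlgebraicComplexity
open Literature.Computability.AlgebraicComplexity.CircuitCode
open Literature.Computability.Complexity.ModularZeroTest
open _root_.Computability Polynomial

/-! ### The randomised identity test is correct on all sufficiently long circuit codes -/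

/-- The degree-bound polynomial `d = X²` of the circuit-code semantics. [cite: Schwartz1980, §3] -/
private def dPoly : Polynomial ℕ := X ^ 2

/-- The height-bound polynomial `h = X² + 3X` of the circuit-code semantics. [cite: Schwartz1980, §3] -/
private def hPoly : Polynomial ℕ := X ^ 2 + Polynomial.C 3 * X

/-- The modulus-length polynomial `K = 4h + 4d + 26`. [cite: AroraBarakCC2009, §7.2.3] -/
private def KPoly : Polynomial ℕ := Polynomial.C 4 * hPoly + Polynomial.C 4 * dPoly + Polynomial.C 26

/-- The block-length polynomial `k = h + 2d + 8`. [cite: AroraBarakCC2009, Lemma 7.5] -/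
private def kPoly : Polynomial ℕ := hPoly + Polynomial.C 2 * dPoly + Polynomial.C 8

/-- `KPoly(n) = KOfH d h n`. [cite: AroraBarakCC2009, §7.2.3] -/
private theorem eval_KPoly (n : ℕ) : KPoly.eval n = KOfH dPoly hPoly n := by
  simp [KPoly, KOfH, dPoly, hPoly]

/-- `kPoly(n) = kOfH d h n`. [cite: AroraBarakCC2009, Lemma 7.5] -/
private theorem eval_kPoly (n : ℕ) : kPoly.eval n = kOfH dPoly hPoly n := by
  simp [kPoly, kOfH, dPoly, hPoly]

/-- **The vanishing of the circuit read off a string is decidable in `BPP`** (indeed `coRP`): the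
randomised modular zero test (Schwartz 1980 / Ibarra–Moran 1983) instantiated with the junk-tolerant
circuit-code semantics `CircuitCode.semPoly` (degree `≤ 2^{n²}`, height `≤ 2^{2^{n²+3n}(B+1)}`) and the
`FP` evaluator `CircuitCode.evalF`. [cite: Schwartz1980, Cor. 1 and §3] [cite: IbarraMoran1983, §4] -/
theorem semPolyZero_mem_BPP : ({w | semPoly w = 0} : Language Bool) ∈ BPP := by
  refine mem_BPP_of_modularZeroTest_height (v := X) (d := dPoly) (h := hPoly) semPoly
    (fun w => totalDegree_semPoly_le w) (fun w B a ha => natAbs_eval_semPoly_le w a ha)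
    (evalF_mem_FP KPoly kPoly) (evalF_oneBit KPoly kPoly) (fun w y hy => ?_)
  rw [eval_coinPolyH, eval_X, ← eval_KPoly, ← eval_kPoly] at hy
  have h := evalF_spec KPoly kPoly w y hy
  rw [eval_KPoly, eval_kPoly] at h
  exact h

/-! ### Agreement with `PITLanguage` on the Kabanets–Impagliazzo instances -/

/-- The Kabanets–Impagliazzo instance has at least `n²` gates (the constant layer of the final
use). [cite: KabanetsImpagliazzo2003, proof of Cor. 12 (p. 358)] -/
theorem sq_le_length_kiCircuit_gates (n : ℕ) (M : Fin n → Fin n → ℤ) (v : ℤ) (P : ℕ → KIReduction.KBlock) :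
    n * n ≤ (KIReduction.kiCircuit n M v P).gates.length := by
  simp [KIReduction.kiCircuit, KIReduction.finalStep, KIReduction.closeIdentity, KIReduction.emitGate,
    KIReduction.emitUse, KIReduction.length_useGates]
  omega

/-- A circuit word is longer than the number of gates of the circuit. [cite: KabanetsImpagliazzo2004, §2] -/
theorem gates_length_le_length_circuitWord (m : ℕ) (C : ArithCircuit ℤ (Fin m)) :
    C.gates.length ≤ (KIReduction.circuitWord m C).length := by
  rw [KIReduction.circuitWord, KIReduction.encodeArithCircuit_eq, length_boolPair, length_boolPair,
    length_boolPair]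
  simp only [ones, List.length_replicate]
  omega

/-- **On every value of the reduction `kiRed`, the `BPP` test agrees with `PITLanguage`**: `kiRed w`
is the code of the instance over `n²` variables with `≥ n²` gates (or the rejected word over `0`
variables), so the word is long enough to host its variables and `semPoly_circuitWord_eq_zero_iff`
applies. [cite: KabanetsImpagliazzo2003, Lemma 11 and proof of Cor. 12 (p. 358)] -/
theorem kiRed_mem_semPolyZero_iff (w : List Bool) :
    KIReduction.kiRed w ∈ ({w | semPoly w = 0} : Language Bool) ↔ KIReduction.kiRed w ∈ PITLanguage := by
  rw [KIReduction.kiRed_apply]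
  split_ifs with hval
  · change semPoly _ = 0 ↔ _
    rw [KIReduction.circuitWord_mem_PITLanguage,
      semPoly_circuitWord_eq_zero_iff _ ((sq_le_length_kiCircuit_gates _ _ _ _).trans
        (gates_length_le_length_circuitWord _ _))]
  · change semPoly _ = 0 ↔ _
    rw [KIReduction.badWord, KIReduction.circuitWord_mem_PITLanguage,
      semPoly_circuitWord_eq_zero_iff _ (Nat.zero_le _)]

/-! ### The discharge -/

/-- **Bläser–Ikenmeyer–Jindal–Lysikov 2018, Thm. 5, DISCHARGED**: "If `VP⁰ = VNP⁰` over
characteristic zero, then `P^{#P} ⊆ ∃BPP`." Proof in the tree: `BIJL2018_thm5_of_randomizedPIT`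
(`BIJL18Thm5OfRandomizedPIT.lean`: `VP⁰ = VNP⁰` ⇒ p-bounded constant-free circuits for the permanent
⇒ guess them and verify ONE identity-test instance `kiRed ⟨x, y⟩` (Kabanets–Impagliazzo 2003,
Lemma 11 / Cor. 12) ⇒ `graph(per) ∈ ∃·BPP` ⇒ `P^{per} ⊆ ∃·BPP` (KI Lemma 3 in the witness class,
`PRelOfFunPolyExists.lean`) ⇒ `P^{#P} ⊆ P^{per} ⊆ ∃·BPP` (Valiant)) applied to the `BPP` identity test
`{w | semPoly w = 0}` (`semPolyZero_mem_BPP`: random point + random modulus, Schwartz 1980 /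
Ibarra–Moran 1983, `RandomizedModularZeroTestHeight.lean`, `CircuitCodeReading.lean`,
`CircuitCodeModularEvaluator.lean`), which agrees with `PITLanguage` on the instances
(`kiRed_mem_semPolyZero_iff`). DEVIATION from the printed proof (ECCC pp. 18–19), disclosed: the
guessed circuits are verified through Kabanets–Impagliazzo's single identity-test instance evaluated
MODULO A RANDOM NUMBER, instead of evaluating the guessed constant-free circuits at random points
directly with the coefficient bound of the paper's Lemma 25 (the tree's circuit codes carry binary
constants and no formal-degree bound, so their values need not have polynomially many bits).
HONEST FRAMING: a 2018 conditional transfer theorem with a Boolean conclusion, now a theorem of the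
tree; `VP ≠ VNP` is NOT proved and nothing here bears on it.
[cite: BlaserIkenmeyerJindalLysikov2018, Thm. 5] locator: ECCC TR18-064 p.6 (statement), pp.18–19 (proof) -/
theorem BIJL2018_thm5_holds : BIJL2018_thm5 :=
  BIJL2018_thm5_of_randomizedPIT semPolyZero_mem_BPP kiRed_mem_semPolyZero_iff

end Literature.Barriers.ValiantsHypothesis

end
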